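import Literature.MathematicalPhysics.QuantumFieldTheory.Balaban1985CMP102.Setting
import Literature.MathematicalPhysics.QuantumFieldTheory.Balaban1983to89.B10StarLower
import Summits.QuantumFields.Balaban3D.Proofs.Constants

/-!
# Bałaban CMP 102 (1985), d = 3 lane — `Proofs.ScalesArithmetic`: the numerical identities of p. 256 for the
# concrete lattice approximations `Setting.Scales L`, and the arithmetic leaf obligations of `B10Assembly.LeafSystem`

Source: T. Bałaban, *Ultraviolet stability of three-dimensional lattice pure gauge field theories*, Commun. Math. Phys.
**102** (1985) 255–275 [Balaban1985UV3] (= [B10]; `paper:balaban1985-cmp102-uv-stability-3d`; journal page = PDF page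
+ 254).  Lane `pub-balaban3d`, seat p3 (PLAN.md §3.1 p3: «the arithmetic `LeafSystem` fields for `run3` (`g_eq,
sites_eq, scale_le_one, g_le_one, …, starT_nonneg, starT_le, …, rem_eq`) … star counts»).

WHAT THIS FILE PROVES (kernel-checked real arithmetic over the spine's `Setting.Scales`; no definition, no `sorry`, nothing
of the paper is asserted — every statement is an identity or inequality between the numbers p. 256 DEFINES):
* §1 the volumes: «|T_ε| = Σ_{x∈T_ε} ε³» (3) p. 256 L22–23 equals `ε³·#T_ε` (`volT_eq`); «|T₁^{(k)}| = Σ_{y∈T₁^{(k)}} 1 = Σ_{x∈T_η}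
  η³ = (L^kε)^{−3}|T_ε|» p. 256 L39 — the printed EQUALITY between the first expression (the site count of the level-`k` torus
  of `Setup`, `Scales.sitesOne`) and the last (`Scales.sites` = `B10.sitesRun`), for `k ≤ m + K` (`sites_eq_card`,
  `sites_eq_sitesOne`; left to this seat by the docstring of `Setting.Scales.sites`); at the terminal scale «L^Kε = ε₀» p. 256
  L18: `|T₁^{(K)}| = ε₀^{−3}|T_ε|` (`sites_K_eq`), the input `hsites` of `B10Ineq3Terminal.ineq3_of_bounds5At`.
* §2 the scales: `L^kε ≤ L^Kε = ε₀` for `k ≤ K` (`pow_mul_eps_le_eps0`).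
* §3 the couplings «g_k = g(L^kε)^{1/2}» p. 256 L39: `g_k² = g²·L^kε` (`gk_sq`), `g₀² = g²ε` = (1) p. 256 L4 (`gk_zero_sq`),
  monotonicity in `k`, `g_K = gε₀^{1/2}` (`gk_K_eq`, the input `hgK` of `B10Ineq3Terminal.ineq3_constant_eq`), and
  `g_k ≤ 1` for `k ≤ K` under the one side condition `g²ε₀ ≤ 1` (`gk_le_one`) — the `LeafSystem` field `g_le_one` (LQB:
  «for g_{k−1} sufficiently small» p. 267, «for g_j sufficiently small» p. 273).
* §4 the NORMALISED SCALING (lane STATUS P3-F1): with `B10Assembly.Consts.g := 1` and `LeafSystem.ε := g₀² = g²ε`,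
  `LeafSystem.Tε := g⁶|T_ε|`, the fields `g_eq`, `sites_eq` of `B10Assembly.LeafSystem` are the identities `gk_eq_gRun_norm`,
  `sites_eq_sitesRun_norm`, and `scale_le_one` is `norm_scale_le_one` (`L^k·g₀² = g_k² ≤ 1`); so ONE `Consts` serves every
  bare coupling `g`.
* §5 the star count «|T₁^{(k)*}|» of (18) p. 260 / (62) p. 271 for the concrete tori (`B10StarCount.starCount univ` at level
  `k + 1` of `S.P`, `d = 3`): `= 2(1 − L⁻³)|T₁^{(k)}|` (`starCount_univ_eq`), hence the `LeafSystem` fields `starT_nonneg`,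
  `starT_le` (`≤ 3|T₁^{(k)}|`) and the reader's item (R2) of `B10DagLeaf` (`≥ (7/4)|T₁^{(k)}|`) for step pieces that record
  this count (`starCount_univ_nonneg`, `starCount_univ_le_three_sites`, `seven_fourths_sites_le_starCount`).
HONEST FRAMING (PLAN §0): arithmetic of the printed definitions only; value = the E2 rung of PLAN §0.5 for the thirteen
arithmetic `LeafSystem` fields, carrier-independent, to be instantiated by `rfl`/one-liners once `toTowerRun` (spine
`SectB`) and the carriers (seat p1) land.  Not summit progress; nothing about Yang–Mills.
-/

namespace Summit.QuantumFields.Balaban3D.Proofs.ScalesArithmetic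

open Literature.MathematicalPhysics.QuantumFieldTheory.Balaban1983to89
open Literature.MathematicalPhysics.QuantumFieldTheory.Balaban1985CMP102.Setting
open Summit.QuantumFields.Balaban3D.Proofs.Constants

variable {L : ℕ}

/-! ## §0 The parameters of the concrete tori (`Scales.P = params3`, d = 3) -/

/-- The lattice parameters of a `Scales` are `⟨3, L, m, K⟩` (definitional). [folklore] -/
theorem P_d (S : Scales L) : S.P.d = 3 := rfl

/-- (definitional) [folklore] -/
theorem P_L (S : Scales L) : S.P.L = L := rfl

/-- (definitional) [folklore] -/
theorem P_m (S : Scales L) : S.P.m = S.m := rfl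

/-- (definitional) [folklore] -/
theorem P_K (S : Scales L) : S.P.K = S.K := rfl

/-- `1 < L` as reals (from `Scales.hL`). [folklore] -/
theorem one_lt_L (S : Scales L) : (1 : ℝ) < L := by exact_mod_cast S.hL.2

/-- `0 < L` as reals. [folklore] -/
theorem L_pos (S : Scales L) : (0 : ℝ) < L := lt_trans one_pos (one_lt_L S)

/-- `2 ≤ L` as reals (`L` odd and `> 1`, so in fact `L ≥ 3`). [folklore] -/
theorem two_le_L (S : Scales L) : (2 : ℝ) ≤ L := by
  have h := S.hL.2
  exact_mod_cast (show (2 : ℕ) ≤ L by omega)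

/-- `0 < L^k ε`. [folklore] -/
theorem pow_mul_eps_pos (S : Scales L) (k : ℕ) : 0 < (L : ℝ) ^ k * S.ε := by
  have := L_pos S
  have := S.ε_pos
  positivity

/-! ## §1 The volumes «|T_ε| = Σ_{x∈T_ε} ε³» (3) and «|T₁^{(k)}| = Σ_y 1 = Σ_x η³ = (L^kε)^{−3}|T_ε|» (after (5)), p. 256 -/

/-- (3) p. 256 = PDF 2 L22–23 «|T_ε| = Σ_{x∈T_ε} ε³»: the sum is `ε³` times the number of sites of `T_ε`. [cite: Balaban1985UV3, (3) p.256] -/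
theorem volT_eq (S : Scales L) : S.volT = (Fintype.card (Site S.P 0) : ℝ) * S.ε ^ 3 := by
  unfold Scales.volT
  rw [Finset.sum_const, Finset.card_univ, nsmul_eq_mul]

/-- `|T_ε| > 0`. [folklore] -/
theorem volT_pos (S : Scales L) : 0 < S.volT := by
  rw [volT_eq]
  have h1 : 0 < Fintype.card (Site S.P 0) := Fintype.card_pos
  have h2 : (0 : ℝ) < Fintype.card (Site S.P 0) := by exact_mod_cast h1
  have := S.ε_pos
  positivity

/-- The number of sites of the level-`k` torus of `Setup`: `(2L^{m+K−k})³` (`Site.card_site`, `Params.sitesPerDir`, d = 3).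
[folklore] -/
theorem card_site_eq (S : Scales L) (k : ℕ) : (Fintype.card (Site S.P k) : ℝ) = (2 * (L : ℝ) ^ (S.m + S.K - k)) ^ 3 := by
  rw [Site.card_site]
  show ((S.P.sitesPerDir k ^ 3 : ℕ) : ℝ) = _
  unfold Params.sitesPerDir
  rw [P_L, P_m, P_K]
  push_cast
  ring

/-- p. 256 = PDF 2 L39 «|T₁^{(k)}| = Σ_{y∈T₁^{(k)}} 1 = Σ_{x∈T_η} η³ = (L^kε)^{−3}|T_ε|»: the LAST printed expression
(`Scales.sites k = B10.sitesRun L ε |T_ε| k`) EQUALS the number of sites of the torus `T^{(k)}` of `Setup`, for every level in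
the standing range `k ≤ m + K` (the identity the docstring of `Setting.Scales.sites` leaves to this seat).  Arithmetic:
`(L^kε)^{−3}·ε³(2L^{m+K})³ = (2L^{m+K−k})³`. [cite: Balaban1985UV3, (5) p.256] -/
theorem sites_eq_card (S : Scales L) (k : ℕ) (hk : k ≤ S.m + S.K) : S.sites k = Fintype.card (Site S.P k) := by
  unfold Scales.sites B10.sitesRun
  rw [volT_eq, card_site_eq S 0, card_site_eq S k, Nat.sub_zero]
  have hsplit : (L : ℝ) ^ (S.m + S.K) = (L : ℝ) ^ (S.m + S.K - k) * (L : ℝ) ^ k := by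
    rw [← pow_add, Nat.sub_add_cancel hk]
  have hL : (L : ℝ) ^ k ≠ 0 := pow_ne_zero _ (L_pos S).ne'
  have hε : S.ε ≠ 0 := S.ε_pos.ne'
  rw [hsplit]
  field_simp

/-- The same with the FIRST printed expression «Σ_{y∈T₁^{(k)}} 1» (`Scales.sitesOne`). [cite: Balaban1985UV3, (5) p.256] -/
theorem sites_eq_sitesOne (S : Scales L) (k : ℕ) (hk : k ≤ S.m + S.K) : S.sites k = S.sitesOne k := by
  rw [sites_eq_card S k hk]
  unfold Scales.sitesOne
  rw [Finset.sum_const, Finset.card_univ, nsmul_eq_mul, mul_one]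

/-- `|T₁^{(k)}| > 0` (every `k`). [folklore] -/
theorem sites_pos (S : Scales L) (k : ℕ) : 0 < S.sites k := by
  unfold Scales.sites B10.sitesRun
  have := pow_mul_eps_pos S k
  have := volT_pos S
  positivity

/-- `|T₁^{(k)}| ≥ 0`. [folklore] -/
theorem sites_nonneg (S : Scales L) (k : ℕ) : 0 ≤ S.sites k := (sites_pos S k).le

/-- `|T₁^{(k+1)}| = L⁻³|T₁^{(k)}|` — the factor `L^{−3(j−k)}` of (65) p. 273 L5 (`B10.sitesRun_shift`). [cite: Balaban1985UV3, (65) p.273] -/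
theorem sites_succ (S : Scales L) (k : ℕ) : S.sites (k + 1) = ((L : ℝ) ^ 3)⁻¹ * S.sites k := by
  unfold Scales.sites
  rw [B10.sitesRun_shift (L : ℝ) S.ε S.volT k 1, pow_one]

/-- AT THE TERMINAL SCALE «L^Kε = ε₀» (p. 256 L18): `|T₁^{(K)}| = ε₀^{−3}|T_ε|` — the hypothesis `hsites` of
`B10Ineq3Terminal.ineq3_of_bounds5At` ((5)_K ⇒ (3)). [cite: Balaban1985UV3, (3) + (5) p.256] -/
theorem sites_K_eq (S : Scales L) : S.sites S.K = S.ε₀⁻¹ ^ 3 * S.volT := by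
  unfold Scales.sites B10.sitesRun
  rw [S.hK]

/-! ## §2 The scales `L^kε ≤ L^Kε = ε₀` (p. 256 L16–18) -/

/-- `ε₀ = L^Kε > 0`. [folklore] -/
theorem eps0_pos (S : Scales L) : 0 < S.ε₀ := by
  rw [← S.hK]
  exact pow_mul_eps_pos S S.K

/-- `L^kε ≤ ε₀` for `k ≤ K` («L^Kε = ε₀», `L > 1`). [cite: Balaban1985UV3, (2) p.256] -/
theorem pow_mul_eps_le_eps0 (S : Scales L) (k : ℕ) (hk : k ≤ S.K) : (L : ℝ) ^ k * S.ε ≤ S.ε₀ := by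
  rw [← S.hK]
  exact mul_le_mul_of_nonneg_right (pow_le_pow_right₀ (one_lt_L S).le hk) S.ε_pos.le

/-! ## §3 The couplings «g_k = g(L^kε)^{1/2}» (p. 256 L39), «g₀² = g²ε» ((1) p. 256 L4) -/

/-- `g_k = g·(L^kε)^{1/2}` (definitional: `Scales.gk = B10.gRun`). [cite: Balaban1985UV3, (5) p.256] -/
theorem gk_def (S : Scales L) (k : ℕ) : S.gk k = S.g * Real.sqrt ((L : ℝ) ^ k * S.ε) := rfl

/-- `g_k > 0`. [folklore] -/
theorem gk_pos (S : Scales L) (k : ℕ) : 0 < S.gk k :=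
  B10.gRun_pos S.g (L : ℝ) S.ε S.g_pos (L_pos S) S.ε_pos k

/-- `g_k² = g²·L^kε`. [cite: Balaban1985UV3, (5) p.256] -/
theorem gk_sq (S : Scales L) (k : ℕ) : S.gk k ^ 2 = S.g ^ 2 * ((L : ℝ) ^ k * S.ε) := by
  rw [gk_def, mul_pow, Real.sq_sqrt (pow_mul_eps_pos S k).le]

/-- `g₀² = g²ε` = `Scales.g0sq` ((1) p. 256 L4 «g₀² = g²ε^{4−d} = g²ε (d = 3)»). [cite: Balaban1985UV3, (1) p.256] -/
theorem gk_zero_sq (S : Scales L) : S.gk 0 ^ 2 = S.g0sq := by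
  rw [gk_sq]
  unfold Scales.g0sq
  rw [pow_zero, one_mul]

/-- The couplings GROW along the flow: `g_j ≤ g_k` for `j ≤ k` (d = 3; no asymptotic freedom bookkeeping). [folklore] -/
theorem gk_mono (S : Scales L) {j k : ℕ} (hjk : j ≤ k) : S.gk j ≤ S.gk k := by
  rw [gk_def, gk_def]
  refine mul_le_mul_of_nonneg_left (Real.sqrt_le_sqrt ?_) S.g_pos.le
  exact mul_le_mul_of_nonneg_right (pow_le_pow_right₀ (one_lt_L S).le hjk) S.ε_pos.le

/-- AT THE TERMINAL SCALE: `g_K = g·ε₀^{1/2}` — the hypothesis `hgK` of `B10Ineq3Terminal.ineq3_constant_eq` («with a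
constant O(1) depending on g and ε₀ only», (3) p. 256 L24). [cite: Balaban1985UV3, (3) + (5) p.256] -/
theorem gk_K_eq (S : Scales L) : S.gk S.K = S.g * Real.sqrt S.ε₀ := by
  rw [gk_def, S.hK]

/-- `g_k ≤ g_K = g·ε₀^{1/2}` for `k ≤ K`. [folklore] -/
theorem gk_le_gK (S : Scales L) (k : ℕ) (hk : k ≤ S.K) : S.gk k ≤ S.g * Real.sqrt S.ε₀ := by
  rw [← gk_K_eq]
  exact gk_mono S hk

/-- `g_k² ≤ g²ε₀` for `k ≤ K`. [folklore] -/
theorem gk_sq_le (S : Scales L) (k : ℕ) (hk : k ≤ S.K) : S.gk k ^ 2 ≤ S.g ^ 2 * S.ε₀ := by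
  rw [gk_sq]
  exact mul_le_mul_of_nonneg_left (pow_mul_eps_le_eps0 S k hk) (sq_nonneg _)

/-- **`g_k ≤ 1` for every `k ≤ K` under the one side condition `g²ε₀ ≤ 1`** (i.e. `g_K ≤ 1`) — the `LeafSystem` field
`g_le_one` of `B10Assembly` (p. 267 L7–8 «for g_{k−1} sufficiently small», p. 273 «for g_j sufficiently small»; p. 256 L16–17
«ε₀ is a positive constant depending on the coupling constant g only»). [cite: Balaban1985UV3, p.256 + p.267 + p.273] -/
theorem gk_le_one (S : Scales L) (h : S.g ^ 2 * S.ε₀ ≤ 1) (k : ℕ) (hk : k ≤ S.K) : S.gk k ≤ 1 := by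
  have h2 : S.gk k ^ 2 ≤ 1 := (gk_sq_le S k hk).trans h
  have h0 := gk_pos S k
  nlinarith

/-! ## §4 Normalised scaling: the `LeafSystem` fields `g_eq`, `sites_eq`, `scale_le_one` with `Consts.g = 1`,
`ε ↦ g₀² = g²ε`, `|T_ε| ↦ g⁶|T_ε|` (lane STATUS P3-F1) -/

/-- `g₀² > 0`. [folklore] -/
theorem g0sq_pos (S : Scales L) : 0 < S.g0sq := by
  unfold Scales.g0sq
  have := S.g_pos
  have := S.ε_pos
  positivity

/-- `g⁶|T_ε| ≥ 0`. [folklore] -/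
theorem normVol_nonneg (S : Scales L) : 0 ≤ S.g ^ 6 * S.volT := by
  have := S.g_pos
  have := volT_pos S
  positivity

/-- **`g_eq` normalised**: `g_k = gRun 1 L (g²ε) k`, i.e. `g(L^kε)^{1/2} = (L^k·g²ε)^{1/2}`. [cite: Balaban1985UV3, (1) + (5) p.256] -/
theorem gk_eq_gRun_norm (S : Scales L) (k : ℕ) : S.gk k = B10.gRun 1 (L : ℝ) S.g0sq k := by
  unfold Scales.gk B10.gRun Scales.g0sq
  rw [one_mul, show (L : ℝ) ^ k * (S.g ^ 2 * S.ε) = S.g ^ 2 * ((L : ℝ) ^ k * S.ε) by ring,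
    Real.sqrt_mul (sq_nonneg _), Real.sqrt_sq S.g_pos.le]

/-- `L^k·g₀² = g_k²`. [cite: Balaban1985UV3, (1) + (5) p.256] -/
theorem norm_scale_eq (S : Scales L) (k : ℕ) : (L : ℝ) ^ k * S.g0sq = S.gk k ^ 2 := by
  rw [gk_sq]
  unfold Scales.g0sq
  ring

/-- **`scale_le_one` normalised**: `L^k·g₀² ≤ 1` for `k ≤ K` under `g²ε₀ ≤ 1`. [cite: Balaban1985UV3, p.256] -/
theorem norm_scale_le_one (S : Scales L) (h : S.g ^ 2 * S.ε₀ ≤ 1) (k : ℕ) (hk : k ≤ S.K) : (L : ℝ) ^ k * S.g0sq ≤ 1 := by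
  rw [norm_scale_eq]
  exact (gk_sq_le S k hk).trans h

/-- **`sites_eq` normalised**: `|T₁^{(k)}| = sitesRun L (g²ε) (g⁶|T_ε|) k`, i.e. `(L^kε)^{−3}|T_ε| = (L^k g²ε)^{−3}·g⁶|T_ε|`.
[cite: Balaban1985UV3, (5) p.256] -/
theorem sites_eq_sitesRun_norm (S : Scales L) (k : ℕ) : S.sites k = B10.sitesRun (L : ℝ) S.g0sq (S.g ^ 6 * S.volT) k := by
  unfold Scales.sites B10.sitesRun Scales.g0sq
  have hg : S.g ≠ 0 := S.g_pos.ne'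
  have hL : (L : ℝ) ^ k ≠ 0 := pow_ne_zero _ (L_pos S).ne'
  have hε : S.ε ≠ 0 := S.ε_pos.ne'
  field_simp

/-- The normalised remainder unit: `(L^k·g₀²)^{3+κ₀}|T₁^{(k)}| = (g_k²)^{3+κ₀}|T₁^{(k)}|` — how the step pieces' `rem` must read
for `LeafSystem.rem_eq` with the normalised constants (p. 269 L24: the remainders are `O(g_k⁷p¹⁸(g_k))·vol`, and
`g_k⁷ = (g_k²)^{7/2}`). [cite: Balaban1985UV3, p.262 + p.269] -/
theorem norm_rem_eq (S : Scales L) (κ₀ : ℝ) (k : ℕ) :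
    ((L : ℝ) ^ k * S.g0sq) ^ (3 + κ₀) * S.sites k = (S.gk k ^ 2) ^ (3 + κ₀) * S.sites k := by
  rw [norm_scale_eq]

/-! ## §5 The star count «|T₁^{(k)*}|» of (18) p. 260 / (62) p. 271 on the concrete d = 3 tori -/

/-- **«|T₁^{(k)*}| = 2(1 − L⁻³)|T₁^{(k)}|»** for the concrete tori: the whole-lattice star count of p. 260 (after (18): «the
number of bonds belonging to Ω₁ minus the number of bonds in Ω₁^{(1)} and minus the number of bonds in the axial gauge fixing
set», Ω₁ = the whole unit lattice `T₁^{(k)}` = level `k` of `S.P`, coarse lattice level `k + 1`) is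
`B10StarLower.starCount_univ_real_d3` with `|T₁^{(k)}| = #T^{(k)}` (`sites_eq_card`). [cite: Balaban1985UV3, (18) p.260 + (62) p.271] -/
theorem starCount_univ_eq (S : Scales L) (k : ℕ) (hk : k + 1 ≤ S.m + S.K) :
    (B10StarCount.starCount (Finset.univ : Finset (Site S.P (k + 1))) : ℝ)
      = 2 * (1 - ((L : ℝ) ^ 3)⁻¹) * S.sites k := by
  rw [B10StarLower.starCount_univ_real_d3 (P := S.P) (P_d S) hk, sites_eq_card S k (by omega), P_L]

/-- `|T₁^{(k)*}| ≥ 0` — the `LeafSystem` field `starT_nonneg` for step pieces recording the concrete count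
(`B10StarCount.starCount_nonneg`). [cite: Balaban1985UV3, (18) p.260] -/
theorem starCount_univ_nonneg (S : Scales L) (k : ℕ) (hk : k + 1 ≤ S.m + S.K) :
    (0 : ℝ) ≤ (B10StarCount.starCount (Finset.univ : Finset (Site S.P (k + 1))) : ℝ) := by
  exact_mod_cast B10StarCount.starCount_nonneg hk Finset.univ

/-- **`|T₁^{(k)*}| ≤ 3|T₁^{(k)}|`** — the `LeafSystem` field `starT_le` for step pieces recording the concrete count («T₁^{(k)*} ⊂
the bonds of the 3-torus»; `B10StarLower.starCount_univ_real_le` at d = 3). [cite: Balaban1985UV3, (18) p.260 + (62) p.271] -/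
theorem starCount_univ_le_three_sites (S : Scales L) (k : ℕ) (hk : k + 1 ≤ S.m + S.K) :
    (B10StarCount.starCount (Finset.univ : Finset (Site S.P (k + 1))) : ℝ) ≤ 3 * S.sites k := by
  have h := B10StarLower.starCount_univ_real_le (P := S.P) hk
  rw [sites_eq_card S k (by omega)]
  rw [P_d] at h
  exact_mod_cast h

/-- **`(7/4)|T₁^{(k)}| ≤ |T₁^{(k)*}|`** — the reader's item (R2) `B10DagLeaf.StarLower … (7/4)` of the negative edge, for step
pieces recording the concrete count (`7/4 ≤ 2(1 − L⁻³)`, `L ≥ 2`: `B10StarLower.seven_fourths_le`). [cite: Balaban1985UV3, (18) p.260 + (62) p.271] -/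
theorem seven_fourths_sites_le_starCount (S : Scales L) (k : ℕ) (hk : k + 1 ≤ S.m + S.K) :
    7 / 4 * S.sites k ≤ (B10StarCount.starCount (Finset.univ : Finset (Site S.P (k + 1))) : ℝ) := by
  rw [starCount_univ_eq S k hk]
  exact mul_le_mul_of_nonneg_right (B10StarLower.seven_fourths_le (L : ℝ) (two_le_L S)) (sites_nonneg S k)

/-- Bridge to the LITERAL remainder unit of (41) p. 266 L21 «Σ_{j=0}^{k−1} O((L^jε)^{3+κ₀})|T₁^{(j)}|»: `(g_k²)^{3+κ₀} =
(g²)^{3+κ₀}·(L^kε)^{3+κ₀}`, so a remainder booked as `Σ_j r·(L^jε)^{3+κ₀}|T₁^{(j)}|` with the j-independent coefficient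
`r = rstar·(g²)^{3+κ₀}` (ruling R-NORM: «coefficient r_j := CR·g^{6+2κ₀}») IS `rstar·Σ_j (g_j²)^{3+κ₀}|T₁^{(j)}|`. [cite: Balaban1985UV3, (41) p.266] -/
theorem gk_sq_rpow (S : Scales L) (κ₀ : ℝ) (k : ℕ) :
    (S.gk k ^ 2) ^ (3 + κ₀) = (S.g ^ 2) ^ (3 + κ₀) * ((L : ℝ) ^ k * S.ε) ^ (3 + κ₀) := by
  rw [gk_sq, Real.mul_rpow (sq_nonneg _) (pow_mul_eps_pos S k).le]

/-- The literal-to-normalised remainder sum: `Σ_{j<k} (r·(L^jε)^{3+κ₀})·|T₁^{(j)}| = rstar·Σ_{j<k} (g_j²)^{3+κ₀}|T₁^{(j)}|` for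
`r = rstar·(g²)^{3+κ₀}`. [cite: Balaban1985UV3, (41) p.266] -/
theorem remainder_sum_literal_eq (S : Scales L) (rstar κ₀ : ℝ) (k : ℕ) :
    ∑ j ∈ Finset.range k, (rstar * (S.g ^ 2) ^ (3 + κ₀)) * ((L : ℝ) ^ j * S.ε) ^ (3 + κ₀) * S.sites j
      = rstar * ∑ j ∈ Finset.range k, (S.gk j ^ 2) ^ (3 + κ₀) * S.sites j := by
  rw [Finset.mul_sum]
  refine Finset.sum_congr rfl (fun j _ => ?_)
  rw [gk_sq_rpow]
  ring

/-! ## §6 The large-localization factor «exp(−R(g_k))» in g_k-units (p. 262 L28–29, p. 270 L32–33) -/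

/-- **«exp(−R), which is smaller than arbitrary power of ε»** (p. 262 L28–29; k ≥ 1: p. 270 «Terms with domains X, which are not
contained in a cube of the size R(g_k)M₁, are estimated by O((L^kε)^{3+κ₀})|T₁^{(k)}|») IN g_k-UNITS: for `k ≤ K` (so `g_k ≤ 1`),
`r₀ ≥ 1`, `2(3 + κ₀) ≤ R₁`, `3 + κ₀ ≥ 0`, `A ≥ 0` and a volume `0 ≤ vol ≤ |T₁^{(k)}|`,
`A·g_k·vol·exp(−R₁r(g_k)) ≤ A e^{−R₁}·(g_k²)^{3+κ₀}|T₁^{(k)}|` — the 4D cell's `B10Assembly.largeLoc_run_le` with the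
normalised dictionary (`g := 1`, `ε := g₀²`), one power `g_k ≤ 1` given away.  Serves seat p5's `hlarge` and p6's vacuum-sum
large-localization term with the k-, ε- and g-free constant `A e^{−R₁}` (R₁ ≥ 6 + 2κ₀: the 4D cell's located largeness, not
printed). [cite: Balaban1985UV3, p.262 + p.270] -/
theorem largeLoc_le_normRem (S : Scales L) {r₀ R₁ κ₀ A vol : ℝ} (k : ℕ) (hk : k ≤ S.K) (hr : 1 ≤ r₀)
    (hκ : 0 ≤ 3 + κ₀) (hR : 2 * (3 + κ₀) ≤ R₁) (hA : 0 ≤ A) (hv0 : 0 ≤ vol) (hv : vol ≤ S.sites k) :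
    A * S.gk k * vol * Real.exp (-(R₁ * B10.rFun r₀ (S.gk k)))
      ≤ A * Real.exp (-R₁) * ((S.gk k ^ 2) ^ (3 + κ₀) * S.sites k) := by
  have hg1 : S.gk k ≤ 1 := gk_le_one S S.gK_le_one k hk
  have hg0 : 0 < S.gk k := gk_pos S k
  have h1 : Real.exp (-(R₁ * B10.rFun r₀ (S.gk k))) ≤ Real.exp (-R₁) * (S.gk k ^ 2) ^ (3 + κ₀) := by
    have h := B10Assembly.largeLoc_run_le 1 (L : ℝ) S.g0sq r₀ R₁ (3 + κ₀) k one_pos (L_pos S) (g0sq_pos S) hr hκ hR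
      (by rw [← gk_eq_gRun_norm]; exact hg1)
    rw [← gk_eq_gRun_norm, Real.one_rpow, mul_one, norm_scale_eq] at h
    exact h
  have hs0 : 0 ≤ S.sites k := sites_nonneg S k
  have step1 : A * S.gk k ≤ A * 1 := mul_le_mul_of_nonneg_left hg1 hA
  have step2 : A * S.gk k * vol ≤ A * 1 * S.sites k := mul_le_mul step1 hv hv0 (by positivity)
  have step3 := mul_le_mul step2 h1 (Real.exp_pos _).le (by positivity)
  calc A * S.gk k * vol * Real.exp (-(R₁ * B10.rFun r₀ (S.gk k)))
      ≤ A * 1 * S.sites k * (Real.exp (-R₁) * (S.gk k ^ 2) ^ (3 + κ₀)) := step3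
    _ = A * Real.exp (-R₁) * ((S.gk k ^ 2) ^ (3 + κ₀) * S.sites k) := by ring

/-! ## §7 The exhibited terminal spacing `ε₀(g) = (min γ₀ 1)²/g²` on the concrete approximations (ruling R-EPS0′) -/

/-- On the exhibited family `S.ε₀ = ε₀(S.g)`: the terminal coupling IS `min γ₀ 1` — «g_K = gε₀^{1/2}». [cite: Balaban1985UV3, (2) + (5) p.256] -/
theorem gK_eq_of_eps0Of (S : Scales L) {γ₀ : ℝ} (hγ : 0 ≤ γ₀) (hS : S.ε₀ = eps0Of γ₀ S.g) :
    S.gk S.K = min γ₀ 1 := by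
  rw [gk_K_eq, hS, mul_sqrt_eps0Of hγ S.g_pos]

/-- On the exhibited family every running coupling is below the leaf threshold: `g_k ≤ γ₀` for `k ≤ K` (`g_k ≤ g_K = min γ₀ 1`).
This is the lemma (`gk_le_gamma0_of_eps0Of`) the ruling R-EPS0′ asks of this seat. [cite: Balaban1985UV3, (2) p.256 + p.267 L9 + p.273 L27] -/
theorem gk_le_gamma0_of_eps0Of (S : Scales L) {γ₀ : ℝ} (hγ : 0 ≤ γ₀) (hS : S.ε₀ = eps0Of γ₀ S.g) (k : ℕ) (hk : k ≤ S.K) :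
    S.gk k ≤ γ₀ :=
  ((gk_mono S hk).trans_eq (gK_eq_of_eps0Of S hγ hS)).trans (min_le_left _ _)

/-- THE EXHIBITED FAMILY CONTAINS ARBITRARILY FINE LATTICES: for every `g > 0`, `γ₀ > 0` and `δ > 0` there is an approximation
with coupling `g`, `ε₀ = ε₀(g)`, `K ≥ 1` steps and bare lattice coupling `g₀² = g²ε < δ` (take `L^K > (min γ₀ 1)²/δ`,
`ε = ε₀/L^K`, `m = 0`).  Serves the fine-lattice hypothesis of the negative edge on the R-EPS0′ family. [cite: Balaban1985UV3, (2)–(3) p.256] -/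
theorem scales_fine_eps0Of (hL : Odd L ∧ 1 < L) {γ₀ g : ℝ} (hγ : 0 < γ₀) (hg : 0 < g) (δ : ℝ) (hδ : 0 < δ) :
    ∃ S : Scales L, S.g = g ∧ S.ε₀ = eps0Of γ₀ S.g ∧ 1 ≤ S.K ∧ S.g0sq < δ := by
  have hL1 : (1 : ℝ) < L := by exact_mod_cast hL.2
  have hL0 : (0 : ℝ) < L := lt_trans one_pos hL1
  obtain ⟨K₀, hK₀⟩ := pow_unbounded_of_one_lt ((min γ₀ 1) ^ 2 / δ) hL1
  have hLK : (0 : ℝ) < (L : ℝ) ^ (K₀ + 1) := pow_pos hL0 _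
  have hLK' : (min γ₀ 1) ^ 2 / δ < (L : ℝ) ^ (K₀ + 1) :=
    hK₀.trans_le (pow_le_pow_right₀ hL1.le (Nat.le_succ K₀))
  have he0p : 0 < eps0Of γ₀ g := eps0Of_pos hγ hg
  -- fields in order: hL, m, K, ε, ε_pos, ε₀, hK, g, g_pos, gK_le_one
  refine ⟨⟨hL, 0, K₀ + 1, eps0Of γ₀ g / (L : ℝ) ^ (K₀ + 1), div_pos he0p hLK, eps0Of γ₀ g,
      mul_div_cancel₀ _ hLK.ne', g, hg, gsq_mul_eps0Of_le_one hγ.le hg⟩, rfl, rfl, by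
    show 1 ≤ K₀ + 1
    omega, ?_⟩
  show g ^ 2 * (eps0Of γ₀ g / (L : ℝ) ^ (K₀ + 1)) < δ
  rw [← mul_div_assoc, gsq_mul_eps0Of hg, div_lt_iff₀ hLK]
  have h := (div_lt_iff₀ hδ).mp hLK'
  linarith [mul_comm δ ((L : ℝ) ^ (K₀ + 1))]

/-! ## §8 Big-block counts against `|T₁^{(k)}|` (for the polymer-sum carriers of seats p5/p6: `N³ ≤ |T₁^{(k)}|`) -/

/-- `|T₁^{(k)}| = (#sites per direction of T^{(k)})³` for `k ≤ m + K` (`Site.card_site`, d = 3). [cite: Balaban1985UV3, (5) p.256] -/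
theorem sites_eq_sitesPerDir_pow (S : Scales L) (k : ℕ) (hk : k ≤ S.m + S.K) :
    S.sites k = ((S.P.sitesPerDir k : ℕ) : ℝ) ^ 3 := by
  rw [sites_eq_card S k hk, Site.card_site, P_d]
  push_cast
  ring

/-- **`N³ ≤ |T₁^{(k)}|` for any number `N` of big blocks per direction not exceeding the number of sites per direction** (e.g.
`N = ⌊(2L^{m+K−k})/M₁⌋` blocks of side `M₁ ≥ 1`, p. 257 «blocks of the size M₁»): the count hypothesis of seat p5's
`cumulant58_torus`/`pprT_le_torus` and p6's vacuum-sum carrier. [cite: Balaban1985UV3, (7) p.257] -/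
theorem blocks_cube_le_sites (S : Scales L) (k : ℕ) (hk : k ≤ S.m + S.K) {N : ℕ} (hN : N ≤ S.P.sitesPerDir k) :
    ((N : ℝ)) ^ 3 ≤ S.sites k := by
  rw [sites_eq_sitesPerDir_pow S k hk]
  exact pow_le_pow_left₀ (Nat.cast_nonneg N) (by exact_mod_cast hN) 3

/-- The blocks of side `M₁ ≥ 1`: `(#sites per direction / M₁)³ ≤ |T₁^{(k)}|` (natural-number division). [cite: Balaban1985UV3, (7) p.257] -/
theorem blocks_div_cube_le_sites (S : Scales L) (k : ℕ) (hk : k ≤ S.m + S.K) (M₁ : ℕ) :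
    (((S.P.sitesPerDir k / M₁ : ℕ)) : ℝ) ^ 3 ≤ S.sites k :=
  blocks_cube_le_sites S k hk (Nat.div_le_self _ _)

end Summit.QuantumFields.Balaban3D.Proofs.ScalesArithmetic
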